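import Summits.ResolutionOfSingularities.KangarooAtlas.MizutaniHironakaSide
import Mathlib.AlgebraicGeometry.Scheme
import Mathlib.RingTheory.Spectrum.Prime.Topology
import HarnessLib

/-!
# Mizutani's conjecture — `B_{P,𝔭} = Spec(S/U_+(𝔭)S)` as a SCHEME: its dimension, `m(e) = 2p^e − 1`

Cell topic `Summits/ResolutionOfSingularities/KangarooAtlas` (pub-rosobs); namespace
`Summit.ResolutionOfSingularities.KangarooAtlas.Mizutani`.  Companion to the Lean transcription of the in-house
note MIZUTANI-PROOF-g59 (AI-written, AI-audited; *AI review is weaker than expert review*; not a resolution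
theorem).

Mizutani (Nagoya Math. J. 52 (1973), Def. 1.1, p. 85 L29 – p. 86 L2) DEFINES the Hironaka scheme of a point `p` of
`ℙⁿ` as the affine scheme **`B_{Pⁿ,p} = Spec(S/U_+(p)S)`**, and «`dim B_{Pⁿ,p}`» is the dimension of that scheme.
The tree's Hironaka-side files (`MizutaniHironakaDimension.lean`, `MizutaniHironakaSide.lean`, res-hironaka's
`Literature/…/HironakaGroupSchemeMultiplicity.lean`) read «`dim B_{P,𝔭}`» as the Krull dimension of the RING
`S ⧸ bIdeal k 𝔭` (`bIdeal k 𝔭 = U_+(𝔭)·S`).  This file removes that (harmless) reading step: with Mathlib's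
`AlgebraicGeometry.Spec`, the scheme `Spec (S ⧸ bIdeal k 𝔭)` — Mizutani's `B_{P,𝔭}` VERBATIM — has topological Krull
dimension `ringKrullDim (S ⧸ bIdeal k 𝔭)` (`PrimeSpectrum.topologicalKrullDim_eq_ringKrullDim`), and the cell's
unconditional Hironaka-side theorems are restated about the scheme:

* `topologicalKrullDim_spec_bIdeal` — `dim Spec(S/U_+(𝔭)S) = ringKrullDim (S/U_+(𝔭)S)`;
* `mizutani_thm13_scheme` — Mizutani Thm. 1.3 / Oda p. 1168: `dim B_{P,𝔭} = hsDim k p 𝔭` (`= n + 1 − dim_k (U(𝔭) ∩ L)_e`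
  at the exponent), every point of every `ℙⁿ_k`;
* `mizutani_lowerBound_scheme` — **`2·p^{exponent B(𝔭)} ≤ dim B_{P,𝔭} + 1`** for every point (`m(e) ≥ 2p^e − 1`);
* `mizutani_attained_scheme`, `mizutani_attained_scheme_of_lt_rank` — Mizutani's `H_e`: exponent `e`,
  `dim B_{P,𝔭} + 1 = 2p^e`, over every field with a `p`-independent pair (`m(e) ≤ 2p^e − 1`).

No new definitions, no named facts, no hypotheses beyond `IsPoint`.  (The additive GROUP-scheme structure of
`B_{P,𝔭}` — «a homogeneous additive subgroup scheme of the vector group `Spec(S)`» — is the subject of encloser-2's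
`MizutaniGroupScheme.lean`, not of this file.)

References: [Mizutani1973HironakaGroupSchemes] Def. 1.1 (p. 85–86), Thm. 1.3, Rem. 2.10; [Oda1983HironakaGroupSchemeII]
§2 p. 1168.
-/

noncomputable section

open MvPolynomial AlgebraicGeometry Literature.AlgebraicGeometry.Resolution
  Literature.AlgebraicGeometry.Resolution.HironakaScheme

namespace Summit.ResolutionOfSingularities.KangarooAtlas.Mizutani

universe u

section Scheme

variable (k : Type u) [Field k] (p : ℕ) [hp : Fact p.Prime] [CharP k p] {n : ℕ}
  (𝔭 : Ideal (MvPolynomial (Fin (n + 1)) k))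

omit hp in
/-- **`dim B_{P,𝔭}` as a scheme**: the (topological Krull) dimension of the affine scheme `Spec(S/U_+(𝔭)S)`
(Mizutani Def. 1.1) is the Krull dimension of the ring `S/U_+(𝔭)S` — the reading used throughout the cell's
Hironaka-side files. [cite: Mizutani1973HironakaGroupSchemes, Def. 1.1 (p. 85–86: B_{P,p} = Spec(S/U_+(p)S))] -/
theorem topologicalKrullDim_spec_bIdeal :
    topologicalKrullDim ↥(Spec (CommRingCat.of (MvPolynomial (Fin (n + 1)) k ⧸ bIdeal k 𝔭))) =
      ringKrullDim (MvPolynomial (Fin (n + 1)) k ⧸ bIdeal k 𝔭) :=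
  PrimeSpectrum.topologicalKrullDim_eq_ringKrullDim _

/-- **Mizutani Thm. 1.3 about the scheme**: for every point `𝔭` of `ℙⁿ_k`,
`dim Spec(S/U_+(𝔭)S) = hsDim k p 𝔭` (`= n + 1 − dim_k (L_B)_e = n + 1 − dim_k (U(𝔭) ∩ L)_e` at the exponent `e`;
Oda p. 1168: "the dimension of `B(𝔭)` equals the rank of `L/L_B`"), unconditionally.
[cite: Mizutani1973HironakaGroupSchemes, Thm. 1.3 (dim Spec(S/NS) = dim_k (L_e/N_e)); Oda1983HironakaGroupSchemeII, §2 (p. 1168)] -/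
theorem mizutani_thm13_scheme [𝔭.IsPrime] (hP : IsPoint k 𝔭) :
    topologicalKrullDim ↥(Spec (CommRingCat.of (MvPolynomial (Fin (n + 1)) k ⧸ bIdeal k 𝔭))) =
      (hsDim k p 𝔭 : WithBot ℕ∞) := by
  rw [topologicalKrullDim_spec_bIdeal]
  exact ringKrullDim_quotient_bIdeal_eq_hsDim_holds k p 𝔭 hP

/-- **MIZUTANI'S LOWER BOUND ABOUT THE SCHEME `B_{P,𝔭} = Spec(S/U_+(𝔭)S)`**: for every field `k` of characteristic
`p`, every `n` and every point `𝔭` of `ℙⁿ_k`, `2·p^{exponent B(𝔭)} ≤ dim B_{P,𝔭} + 1` — `m(e) ≥ 2p^e − 1` for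
every `e`, in the vocabulary of Def. 1.1 and Remark 2.10 with no reading step left but «mult = order» for
`U_m(p)` (see `MizutaniProjectiveOrder.lean`).
[cite: Mizutani1973HironakaGroupSchemes, Def. 1.1 and Remark 2.10 ("it is quite likely that m(e) = 2p^e − 1")] -/
theorem mizutani_lowerBound_scheme [𝔭.IsPrime] (hP : IsPoint k 𝔭) :
    (2 * p ^ exponent k p 𝔭 : WithBot ℕ∞) ≤
      topologicalKrullDim ↥(Spec (CommRingCat.of (MvPolynomial (Fin (n + 1)) k ⧸ bIdeal k 𝔭))) + 1 := by
  rw [topologicalKrullDim_spec_bIdeal]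
  exact mizutani_lowerBound_hironaka k p 𝔭 hP

/-- … and for every `e ≤ exponent B(𝔭)`: every point "whose exponent is not less than `e`" has
`dim B_{P,𝔭} ≥ 2p^e − 1`. [cite: Mizutani1973HironakaGroupSchemes, Remark 2.10] -/
theorem mizutani_lowerBound_scheme' [𝔭.IsPrime] (hP : IsPoint k 𝔭) {e : ℕ} (he : e ≤ exponent k p 𝔭) :
    (2 * p ^ e : WithBot ℕ∞) ≤
      topologicalKrullDim ↥(Spec (CommRingCat.of (MvPolynomial (Fin (n + 1)) k ⧸ bIdeal k 𝔭))) + 1 := by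
  rw [topologicalKrullDim_spec_bIdeal]
  exact mizutani_lowerBound_hironaka' k p 𝔭 hP he

end Scheme

section Attained

variable {k : Type u} [Field k] {p e : ℕ} [hp : Fact p.Prime] [CharP k p] {u : Fin 2 → k}

/-- **MIZUTANI'S `H_e` ABOUT THE SCHEME** (`m(e) ≤ 2p^e − 1`): over every field `k` of characteristic `p` with a
`p`-independent pair `u`, for every `e ≥ 1`, the point `attP k p e u` of `ℙ^{2p^e − 2}_k` has a Hironaka scheme
`B_{P,𝔭} = Spec(S/U_+(𝔭)S)` of exponent `e` and dimension `2p^e − 1`.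
[cite: Mizutani1973HironakaGroupSchemes, Remark 2.10 (the schemes H_e: e(H_e) = e, dim H_e = 2p^e − 1)] -/
theorem mizutani_attained_scheme (hu : PIndep p 1 u) (he : 1 ≤ e) :
    exponent k p (GenAtt.attP k p e u) = e ∧
      topologicalKrullDim ↥(Spec (CommRingCat.of
          (MvPolynomial (Fin (attN p e + 1)) k ⧸ bIdeal k (GenAtt.attP k p e u)))) + 1 =
        (2 * p ^ e : WithBot ℕ∞) := by
  rw [topologicalKrullDim_spec_bIdeal]
  exact mizutani_attained_hironaka hu he

/-- The attainment over every field with `[k : k^p] > p`. [cite: Mizutani1973HironakaGroupSchemes, Remark 2.10 ("let k be a field such that [k : k^p] ≥ p^2")] -/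
theorem mizutani_attained_scheme_of_lt_rank (k : Type u) [Field k] (p : ℕ) [Fact p.Prime] [CharP k p]
    (hk : (p : Cardinal.{u}) < Module.rank (frobPow k p 1) k) {e : ℕ} (he : 1 ≤ e) :
    ∃ 𝔭 : Ideal (MvPolynomial (Fin (attN p e + 1)) k), ∃ _ : 𝔭.IsPrime, IsPoint k 𝔭 ∧ exponent k p 𝔭 = e ∧
      topologicalKrullDim ↥(Spec (CommRingCat.of (MvPolynomial (Fin (attN p e + 1)) k ⧸ bIdeal k 𝔭))) + 1 =
        (2 * p ^ e : WithBot ℕ∞) := by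
  obtain ⟨𝔭, h𝔭, hP, hexp, hdim⟩ := mizutani_attained_hironaka_of_lt_rank k p hk he
  exact ⟨𝔭, h𝔭, hP, hexp, by rw [topologicalKrullDim_spec_bIdeal]; exact hdim⟩

end Attained

end Summit.ResolutionOfSingularities.KangarooAtlas.Mizutani

end
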